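import Summits.BirchSwinnertonDyer.BirchSwinnertonDyer.Theorems.KolyvaginDepthDoorMSymbolCertUniqueFParts
import HarnessLib

/-!
# Route `KolyvaginDepthDoor`, crux `KolyvaginDepthSupplyKN` (stmt-BirchSwinnertonDyer-22820) —
# DEPTH TABLE v27, KIT 2d/4: the certificate check in CHUNKS (one kernel evaluation per chunk)

Helper file of the lead prover of line `levelone` (kdd-p1 g31; `--supports stmt-BirchSwinnertonDyer-22820
--as helper`); it closes nothing and BSD is NOT proved by it.

Kit 2c split `CertF.checkF` into four parts; at levels `N ≳ 640` even the peeling part alone exceeds the kernel's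
per-declaration memory bound on some farm nodes. This file lets a data file cut every long evaluation into
chunks, each its own `decide +kernel` (hence its own kernel declaration with fresh reduction caches):
* `CertF.peel_append` — peeling an appended step list is peeling the chunks in turn (`Option.bind`), so
  `peel core (s₀ ++ s₁ ++ ⋯) = some known` follows from `peel knownᵢ sᵢ = some knownᵢ₊₁` chunk by chunk;
* `CertF.partShape`, `CertF.partCover`, `CertF.partPeel_of_peel_eq` — the peeling part from the shape
  conditions, the composed peeling equation and the cover check at the final `known`;
* `evalInt_chunk`, `CertF.partPool_of_forall` — the pool part from range chunks `List.range' lo len`;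
* `sum_range_eq_of_chunks2/3/4` — a `Finset.range` sum (the Kurihara sum `kSum` of kit 4) from the sums of
  2–4 consecutive `List.range'` chunks.
Pure bookkeeping; no mathematics.
-/

set_option linter.dupNamespace false

namespace Summit.BirchSwinnertonDyer.BirchSwinnertonDyer.Theorems.KolyvaginDepthDoor.MSymbolCert

namespace CertF

variable (C : CertF)

/-- **Peeling an appended step list** = peeling the first chunk, then the second from the resulting `known`.
[folklore] -/
theorem peel_append (gen : ℕ → Eqn) : ∀ (s₁ s₂ : List (ℕ × ℕ)) (known : List ℕ),
    C.peel gen known (s₁ ++ s₂) = (C.peel gen known s₁).bind (fun k => C.peel gen k s₂) := by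
  intro s₁
  induction s₁ with
  | nil => intro s₂ known; simp [peel]
  | cons s s₁ ih =>
    intro s₂ known
    obtain ⟨code, j⟩ := s
    simp only [List.cons_append, peel]
    split_ifs with h
    · exact ih s₂ (j :: known)
    · simp

/-- The shape conjuncts of `partPeel` (everything except the peeling itself). [folklore] -/
def partShape (K : ℕ) : Bool :=
  decide (0 < C.m) && decide (1 < C.q) && decide (C.coreEqs.length = C.m - 1) &&
  decide (C.core.length = C.m) &&
  (List.range C.m).all (fun k => (List.range C.m).all fun k' =>
    C.ex (C.cr k) k' == if k = k' then 1 else 0) &&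
  C.steps.all (fun s => decide (s.1 < K)) && C.coreEqs.all (fun k => decide (k < K))

/-- The cover conjuncts of `partPeel` at a given final `known`. [folklore] -/
def partCover (gen : ℕ → Eqn) (X : ℕ) (known : List ℕ) : Bool :=
  (List.range X).all (fun i => decide (i ∈ known)) &&
    C.coreEqs.all (fun k => (gen k).all fun jc => decide (jc.1 ∈ known))

/-- **`partPeel` from the shape part, the (composed) peeling equation and the cover part.** [folklore] -/
theorem partPeel_of_peel_eq (gen : ℕ → Eqn) (K X : ℕ) (known : List ℕ)
    (h1 : C.partShape K = true) (h2 : C.peel gen C.core C.steps = some known)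
    (h3 : C.partCover gen X known = true) : C.partPeel gen K X = true := by
  simp only [partShape, Bool.and_eq_true] at h1
  simp only [partCover, Bool.and_eq_true] at h3
  simp only [partPeel, h2, Bool.and_eq_true]
  exact ⟨h1, h3⟩

/-- **`partPool` from a pointwise statement.** [folklore] -/
theorem partPool_of_forall (gen : ℕ → Eqn) (K : ℕ) (φ : ℕ → ℤ)
    (h : ∀ k < K, evalInt φ (gen k) = 0) (h0 : φ (C.cr 0) ≠ 0) : C.partPool gen K φ = true := by
  simp only [partPool, Bool.and_eq_true, List.all_eq_true, List.mem_range, beq_iff_eq, bne_iff_ne, ne_eq]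
  exact ⟨fun k hk => h k hk, h0⟩

end CertF

/-- A pool chunk `lo ≤ k < lo + len` from its Boolean check on `List.range' lo len`. [folklore] -/
theorem evalInt_chunk {φ : ℕ → ℤ} {gen : ℕ → Eqn} {lo len : ℕ}
    (h : (List.range' lo len).all (fun k => evalInt φ (gen k) == 0) = true) :
    ∀ k, lo ≤ k → k < lo + len → evalInt φ (gen k) = 0 := by
  intro k h1 h2
  simp only [List.all_eq_true, List.mem_range'_1, beq_iff_eq] at h
  exact h k ⟨h1, h2⟩

/-- A `Finset.range` sum from two consecutive `List.range'` chunk sums. [folklore] -/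
theorem sum_range_eq_of_chunks2 {α : Type*} [AddCommMonoid α] (g : ℕ → α) (n a b : ℕ) (hn : a + b = n)
    (va vb : α) (ha : ((List.range' 0 a).map g).sum = va) (hb : ((List.range' a b).map g).sum = vb) :
    ∑ k ∈ Finset.range n, g k = va + vb := by
  rw [← list_range_map_sum, List.range_eq_range', ← hn, ← List.range'_append_1]
  simp only [List.map_append, List.sum_append, Nat.zero_add]
  rw [ha, hb]

/-- A `Finset.range` sum from three consecutive `List.range'` chunk sums. [folklore] -/
theorem sum_range_eq_of_chunks3 {α : Type*} [AddCommMonoid α] (g : ℕ → α) (n a b c : ℕ)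
    (hn : a + b + c = n) (va vb vc : α) (ha : ((List.range' 0 a).map g).sum = va)
    (hb : ((List.range' a b).map g).sum = vb) (hc : ((List.range' (a + b) c).map g).sum = vc) :
    ∑ k ∈ Finset.range n, g k = va + vb + vc := by
  rw [← list_range_map_sum, List.range_eq_range', ← hn, ← List.range'_append_1, ← List.range'_append_1]
  simp only [List.map_append, List.sum_append, Nat.zero_add]
  rw [ha, hb, hc]

/-- A `Finset.range` sum from four consecutive `List.range'` chunk sums. [folklore] -/
theorem sum_range_eq_of_chunks4 {α : Type*} [AddCommMonoid α] (g : ℕ → α) (n a b c d : ℕ)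
    (hn : a + b + c + d = n) (va vb vc vd : α) (ha : ((List.range' 0 a).map g).sum = va)
    (hb : ((List.range' a b).map g).sum = vb) (hc : ((List.range' (a + b) c).map g).sum = vc)
    (hd : ((List.range' (a + b + c) d).map g).sum = vd) :
    ∑ k ∈ Finset.range n, g k = va + vb + vc + vd := by
  rw [← list_range_map_sum, List.range_eq_range', ← hn, ← List.range'_append_1, ← List.range'_append_1,
    ← List.range'_append_1]
  simp only [List.map_append, List.sum_append, Nat.zero_add]
  rw [ha, hb, hc, hd]

end Summit.BirchSwinnertonDyer.BirchSwinnertonDyer.Theorems.KolyvaginDepthDoor.MSymbolCert
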